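import Summits.BirchSwinnertonDyer.BirchSwinnertonDyer.Theorems.SylvesterTwoHeegnerIndexCoupledDescentCebotarevKummerImage
import HarnessLib

/-!
# (hL3b) at `p = 2` for the Sylvester pair: the datum (C4) DISCHARGED from `rank_ℤ E_p(K) = 2`

Leaf (L3b) of VARIANT K (crux `UpperOffV0HSYPlus`, stmt-BirchSwinnertonDyer-19804) at `p = 2`,
package form `exists_cmH1_infinite_kolyvaginPrimes_line_sylvesterPair` (k7t-c2 g20 #12), displays
the datum (C4): a generator `x₁` of the `𝔽₄`-line of the bottom class `y = δY` FIXED by the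
conjugation `c_*` of `H¹(K, E_p[2])`; #13 (`…_of_point`) reduced it to a reflection relation
«`c Y + ε Y` torsion, `ε` odd» on `Y ∈ E_p(K)`.  (That relation is NOT supplied in the CM frame
`K = ℚ(ω)` by the tree's Heegner-frame law `heegnerPoint_conj_add_rootNumber_smul_holds`: its
hypothesis `SatisfiesHeegnerHypothesis (W.conductorNorm ℤ) K` fails there, `3 ∣ N_{E_p}` being
ramified in `ℚ(ω)`.)

This file removes the datum altogether: (C4) holds for EVERY `Y ∈ E_p(K) ∖ 2E_p(K)` once
`rank_ℤ E_p(K) = 2` — a hypothesis the first-layer consumer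
`SylvesterTwoCoupledDescentPrimitivity.natCard_primaryComponent_sha_eq_one_pair_of_display_of_coupledLeaves`
already carries (`hrank`; `Y ∉ 2E(K)` is its `hY₀`).  Argument (`…CebotarevKummerImage.lean`):
`M := δ(E_p(K))` has four elements; the line `L = {0, y, wy, y + wy}` of `y = δY ≠ 0` lies in `M`
(`w ∘ δ = δ ∘ [ζ]`) and has four elements, so `L = M ∋ δ(cY) = c_* δY`; since `c_*² = id`, a case
analysis yields a `c_*`-fixed `x₁ ∈ L ∖ {0}` spanning `L`.

* `exists_cmH1_infinite_kolyvaginPrimes_line_sylvesterPair_of_rank` — (hL3b) at the Sylvester pair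
  with the SAME conclusion as #13's `…_of_point`, hypotheses `¬ ∃ Q, 2 • Q = Y` and
  `rank_ℤ E_p(K) = 2` only (besides the frame `ω, [K:ℚ] = 2, p ≡ 1 (3), c ω = ω²`, levels).
* `mordellWeilRank_baseChange_variableChange`, `mordellWeilRank_cubeSumCurve_of_variableChange` — the
  consumer's `hrank : rank_ℤ B(K) = 2` on a `ℚ`-model `B` (`CB • B = E_p`) transported to `E_p`.
Theorem-only; nothing asserted on 19804; no label moves; BSD not claimed for any curve.
References: Gross 1991 §5 (5.1), §9; McCallum 1991 Cor. 3.2; Silverman AEC VIII.§2, X.4.2.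
-/

set_option linter.dupNamespace false -- Summits modules are `Summit.<Summit>.<Problem>…` by design

noncomputable section

open scoped Classical
open WeierstrassCurve NumberField IsDedekindDomain Field
open Literature.NumberTheory.EllipticCurves Literature.NumberTheory.GaloisRepresentations
open Literature.NumberTheory.EllipticCurves.HuShuYin2019

namespace Summit.BirchSwinnertonDyer.BirchSwinnertonDyer.Theorems.SylvesterTwoCoupledDescentCebotarev

variable {K : Type} [Field K] [NumberField K]

/-- An automorphism `c` of a quadratic field is an involution: `c * c = 1`. [folklore] -/
private theorem algEquiv_mul_self_eq_one (h2 : Module.finrank ℚ K = 2) (c : K ≃ₐ[ℚ] K) :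
    c * c = 1 := by
  haveI : Algebra.IsQuadraticExtension ℚ K := ⟨h2⟩
  have hcard : Nat.card (K ≃ₐ[ℚ] K) = 2 := by rw [IsGalois.card_aut_eq_finrank, h2]
  haveI : Finite (K ≃ₐ[ℚ] K) := Nat.finite_of_card_ne_zero (by rw [hcard]; decide)
  have h : c ^ Nat.card (K ≃ₐ[ℚ] K) = 1 := pow_card_eq_one'
  rwa [hcard, pow_two] at h

/-- **(hL3b) at `p = 2` for the Sylvester pair `(A, B) = (E_{3p²}, E_p)`, (C4) DISCHARGED.** For
`K ∋ ω` quadratic (`ω² + ω + 1 = 0`), `p ≡ 1 (3)` prime, `c ∈ Aut(K/ℚ)` with `c ω = ω²`, and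
`Y ∈ E_p(K)` NOT `2`-divisible with `rank_ℤ E_p(K) = 2`: there are `[ω]`-data `φB / fnB / hfnB` on
`E_p ⁄ K` (as in #12's `exists_cmH1_infinite_kolyvaginPrimes_line_sylvesterPair`) such that for every
`s` off the `𝔽₄`-line of `δY` and every `cl ≠ 0` in `H¹(K, E_{3p²}[2])` there are infinitely many
Kolyvagin primes `ℓ` with `(δY)_λ = 0`, `s_λ ≠ 0`, `cl_λ ≠ 0` — the SAME conclusion as #13's
`…_of_point`, with NO reflection / (C4) datum: the `c_*`-fixed generator `x₁` of the line of `δY`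
exists by `natCard_range_kummerMapTorsion_cubeSumCurve`, `exists_eq_line_of_natCard_le_four` and
`exists_conj_fixed_generator_of_mem_line`. -/
theorem exists_cmH1_infinite_kolyvaginPrimes_line_sylvesterPair_of_rank {ω : K}
    (hω : ω ^ 2 + ω + 1 = 0) (h2 : Module.finrank ℚ K = 2) {p : ℕ} (hp : p.Prime)
    (hp3 : p % 3 = 1) {c : K ≃ₐ[ℚ] K} (hcω : c ω = ω ^ 2) {NA NB : ℕ} [NeZero NA] [NeZero NB]
    (Y : ((cubeSumCurve (p : ℚ)).baseChange K).toAffine.Point)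
    (hY : ¬ ∃ Q : ((cubeSumCurve (p : ℚ)).baseChange K).toAffine.Point, (2 : ℕ) • Q = Y)
    (hrank : ((cubeSumCurve (p : ℚ)).baseChange K).mordellWeilRank = 2) :
    ∃ (φB : geomPoints ((cubeSumCurve (p : ℚ)).baseChange K) →+
        geomPoints ((cubeSumCurve (p : ℚ)).baseChange K))
      (fnB : geomTorsion ((cubeSumCurve (p : ℚ)).baseChange K) ((2 : ℕ) : ℤ) →+
        geomTorsion ((cubeSumCurve (p : ℚ)).baseChange K) ((2 : ℕ) : ℤ))
      (hfnB : ∀ (σ : absoluteGaloisGroup K)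
        (P : geomTorsion ((cubeSumCurve (p : ℚ)).baseChange K) ((2 : ℕ) : ℤ)),
        fnB (ContinuousMonoidHom.id _ σ • P) = σ • fnB P),
      (∀ P, φB (φB P) + φB P + P = 0) ∧
      (∀ (x y : AlgebraicClosure K)
        (h : (((cubeSumCurve (p : ℚ)).baseChange K).baseChange
          (AlgebraicClosure K)).toAffine.Nonsingular x y),
        ∃ h', φB (Affine.Point.some x y h) =
          Affine.Point.some (algebraMap K (AlgebraicClosure K) ω ^ 2 * x) y h') ∧
      (∀ P : geomTorsion ((cubeSumCurve (p : ℚ)).baseChange K) ((2 : ℕ) : ℤ),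
        ((fnB P : geomTorsion ((cubeSumCurve (p : ℚ)).baseChange K) ((2 : ℕ) : ℤ)) :
          geomPoints ((cubeSumCurve (p : ℚ)).baseChange K)) = φB P) ∧
      ∀ s : galH1Torsion ((cubeSumCurve (p : ℚ)).baseChange K) ((2 : ℕ) : ℤ),
        (¬ ∃ a b : ℤ, s = a • kummerClassOfPoint (cubeSumCurve (p : ℚ)) K Nat.prime_two Y +
          b • resH1Hom (ContinuousMonoidHom.id _) fnB hfnB
            (kummerClassOfPoint (cubeSumCurve (p : ℚ)) K Nat.prime_two Y)) →
        ∀ cl : galH1Torsion ((cubeSumCurve (3 * (p : ℚ) ^ 2)).baseChange K) ((2 : ℕ) : ℤ),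
          cl ≠ 0 →
          Set.Infinite {ℓ : ℕ | (ℓ.Prime ∧ ¬ ℓ ∣ NA ∧ ¬ ℓ ∣ NB ∧
              ¬ ((ℓ : ℤ) ∣ NumberField.discr K) ∧ ℓ ≠ 2 ∧ (Ideal.span {(ℓ : 𝓞 K)}).IsPrime ∧
              FrobEqFrobInfty (cubeSumCurve (3 * (p : ℚ) ^ 2)) K 2 ℓ ∧
              FrobEqFrobInfty (cubeSumCurve (p : ℚ)) K 2 ℓ) ∧
            ∀ v : HeightOneSpectrum (𝓞 K), (ℓ : 𝓞 K) ∈ v.asIdeal →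
              kummerClassOfPoint (cubeSumCurve (p : ℚ)) K Nat.prime_two Y ∈
                ((cubeSumCurve (p : ℚ)).baseChange K).torsionLocalKer
                  (v.adicCompletion K) ((2 : ℕ) : ℤ) ∧
              s ∉ ((cubeSumCurve (p : ℚ)).baseChange K).torsionLocalKer
                (v.adicCompletion K) ((2 : ℕ) : ℤ) ∧
              cl ∉ ((cubeSumCurve (3 * (p : ℚ) ^ 2)).baseChange K).torsionLocalKer
                (v.adicCompletion K) ((2 : ℕ) : ℤ)} := by
  obtain ⟨φB, fnB, hfnB, hφBrel, hφB, hcoeB, h⟩ :=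
    exists_cmH1_infinite_kolyvaginPrimes_line_sylvesterPair (NA := NA) (NB := NB) hω h2 hp hp3 hcω
  refine ⟨φB, fnB, hfnB, hφBrel, hφB, hcoeB, fun s hs cl hcl ↦ ?_⟩
  have hp2 : p ≠ 2 := by rintro rfl; norm_num at hp3
  set w := resH1Hom (ContinuousMonoidHom.id _) fnB hfnB with hw_def
  -- the bottom class `y = δY` as a value of the Kummer map `κ`
  obtain ⟨hdiv, hyκ⟩ : ∃ hdiv, kummerClassOfPoint (cubeSumCurve (p : ℚ)) K Nat.prime_two Y =
      kummerMapTorsion ((cubeSumCurve (p : ℚ)).baseChange K) ((2 : ℕ) : ℤ) hdiv Y := ⟨_, rfl⟩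
  set y := kummerClassOfPoint (cubeSumCurve (p : ℚ)) K Nat.prime_two Y with hy_def
  set κ := kummerMapTorsion ((cubeSumCurve (p : ℚ)).baseChange K) ((2 : ℕ) : ℤ) hdiv with hκ
  -- (i) `w² + w + 1 = 0` on `H¹(K, E_p[2])`
  have hreln : ∀ P, fnB (fnB P) + fnB P + P = 0 := fun P ↦ by
    apply Subtype.ext
    change ((fnB (fnB P) : geomTorsion ((cubeSumCurve (p : ℚ)).baseChange K) _) :
        geomPoints ((cubeSumCurve (p : ℚ)).baseChange K)) +
      ((fnB P : geomTorsion ((cubeSumCurve (p : ℚ)).baseChange K) _) :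
        geomPoints ((cubeSumCurve (p : ℚ)).baseChange K)) +
      (P : geomPoints ((cubeSumCurve (p : ℚ)).baseChange K)) = 0
    rw [hcoeB, hcoeB]
    exact hφBrel P
  have hw : ∀ x, w (w x) + w x + x = 0 := resH1Hom_id_apply_apply_add _ fnB hfnB hreln
  -- (ii) `c_*` is an involution
  have hcc : ∀ x, conjAct (cubeSumCurve (p : ℚ)) c ((2 : ℕ) : ℤ)
      (conjAct (cubeSumCurve (p : ℚ)) c ((2 : ℕ) : ℤ) x) = x :=
    conjAct_conjAct_of_mul_self _ (algEquiv_mul_self_eq_one h2 c) _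
  -- (iii) `y ≠ 0`, `2 • y = 0`
  have hy0 : y ≠ 0 := kummerClassOfPoint_ne_zero _ _ _ hY
  have hy2 : (2 : ℤ) • y = 0 := two_zsmul_galH1Torsion_two _ y
  -- (iv) `M = δ(E_p(K))` has four elements and contains `y`, `w y`, `c_* y`
  have hM : Nat.card κ.range = 4 := natCard_range_kummerMapTorsion_cubeSumCurve hω h2 hp hp2 hrank hdiv
  haveI : Finite κ.range := Nat.finite_of_card_ne_zero (by rw [hM]; norm_num)
  have hyM : y ∈ κ.range := ⟨Y, hyκ.symm⟩
  have hwyM : w y ∈ κ.range := by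
    obtain ⟨Y', hY'⟩ := exists_toGeomPoints_eq_apply hω hp φB hφB Y
    refine ⟨Y', ?_⟩
    rw [hyκ]
    exact (resH1Hom_id_kummerMapTorsion _ _ φB (smul_comm_of_apply_some_eq _ ω φB hφB) fnB hfnB
      hcoeB hdiv Y Y' hY').symm
  have hcyM : conjAct (cubeSumCurve (p : ℚ)) c ((2 : ℕ) : ℤ) y ∈ κ.range := by
    refine ⟨Affine.Point.map (W' := cubeSumCurve (p : ℚ)) (c : K →ₐ[ℚ] K) Y, ?_⟩
    rw [hyκ]
    exact (conjAct_kummerMapTorsion (cubeSumCurve (p : ℚ)) c _ hdiv Y).symm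
  -- (v) hence `c_* y` is on the line of `y`, and a `c_*`-fixed generator exists
  obtain ⟨a, b, hab⟩ :=
    exists_eq_line_of_natCard_le_four w hw κ.range hM.le hy0 hy2 hyM hwyM hcyM
  obtain ⟨x₁, hx₁, hyx₁, hline⟩ :=
    exists_conj_fixed_generator_of_mem_line (conjAct (cubeSumCurve (p : ℚ)) c ((2 : ℕ) : ℤ)) w
      hcc hw hy2 ⟨a, b, hab⟩
  exact h y x₁ hx₁ hyx₁ hline s hs cl hcl

/-! ### Transport of `rank_ℤ` along a change of variables (for the consumer's `hrank`) -/

omit [NumberField K] in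
/-- `rank_ℤ (C • B)(L) = rank_ℤ B(L)`: the point groups are isomorphic along
`VariableChange.pointEquivBaseChange`. Silverman, *AEC*, III.3.1(b). [folklore] -/
theorem mordellWeilRank_baseChange_variableChange (B : WeierstrassCurve ℚ) (C : VariableChange ℚ)
    [Algebra ℚ K] : ((C • B).baseChange K).mordellWeilRank = (B.baseChange K).mordellWeilRank :=
  ((VariableChange.pointEquivBaseChange B C K).toIntLinearEquiv.finrank_eq).symm

omit [NumberField K] in
/-- The consumer's `hrank : rank_ℤ B(K) = 2` for a `ℚ`-model `B` with `CB • B = E_p` gives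
`rank_ℤ E_p(K) = 2` (the hypothesis of `exists_cmH1_infinite_kolyvaginPrimes_line_sylvesterPair_of_rank`).
[folklore] -/
theorem mordellWeilRank_cubeSumCurve_of_variableChange [Algebra ℚ K] {p : ℕ} (B : WeierstrassCurve ℚ)
    (CB : VariableChange ℚ) (hCB : CB • B = cubeSumCurve (p : ℚ))
    (hrank : (B.baseChange K).mordellWeilRank = 2) :
    ((cubeSumCurve (p : ℚ)).baseChange K).mordellWeilRank = 2 := by
  rw [← hCB, mordellWeilRank_baseChange_variableChange, hrank]

end Summit.BirchSwinnertonDyer.BirchSwinnertonDyer.Theorems.SylvesterTwoCoupledDescentCebotarev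

end
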